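import Summits.BirchSwinnertonDyer.BirchSwinnertonDyer.Theorems.KimAtThreeKolyvaginIsogenyCruxes
import Summits.BirchSwinnertonDyer.BirchSwinnertonDyer.Theorems.KimAtThreeKolyvaginMinimalCertificate
import HarnessLib

/-!
# Route `KimAtThreeKolyvagin` (rung W2), crux `DeepLowerAtThree` (item 19075): the crux FROM the
# END-shape bound (cell n1011's (a′) END conclusion block, BSD currency) on OPTIMAL parametrised curves only

Cell `bsd-addord`, seat `bsd-addord-kim3` (gen 9). TOOL FILE: one theorem (no definition, no named fact, no
`sorry`); closes nothing (the hypothesis is crux-sized), books nothing. The 19075 twin of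
`KimAtThreeKolyvaginIsogenyEndRow` (19076): it composes
* kim3 g7's `deepLower_datum_of_endShapeBound` (p416944: for a tower row with datum `D`, unit period
  transfer `Ω(W) = u·Ω⁺_{D.f}` and `ord(δ̃) = 0`, the END-shape bound `hEnd` — VERBATIM the conclusion
  block of n1011's `Assembly.padicValRat_le_of_kolyvaginProduct_deep`: every MINIMAL certificate
  `δ̃_n ≢ 0 (mod 3^{j′})` at a cyclic `n ∈ 𝒩_L`, `K + j′ ≤ L + 1`, bounds `ord₃(L(E,1)/Ω) ≤ ord₃ #Ш(3) + (j′−1)`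
  — gives crux 19075's `∂`-conclusion for `D.f`), with
* kim3 g9's `deepLowerAtThree_of_forall_optimalDatum` (p425479),
so that the END producers (n1011's road, the Kato-stratum ports of `…DeepLowerKatoStratum`) need only be
run on globally minimal `W₀` with a lattice-OPTIMAL, degree-MINIMAL datum `D₀` (where the period transfer
is `3 ∤ c_{D₀}`, `X4.periodTransfer_of_optimal`): `deepLowerAtThree_of_endShapeBound_optimal`.

References: [Kim2022StructureSelmer] Thm. 1.9 (6); [MazurRubin2004] Thm. 5.2.12; [Sakamoto2024] Thm. 4.4;
[Kim2025RefinedTNC] Thm 1.1; [EdixhovenManin1991] Prop. 2; memo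
`run/shared/lean/pub/bsd-addord/kim3/KIM3-W2-ISOGENY-g9.md`, `KIM3-PROOF.md` §16 (Cor C-t).
-/

-- the Theorems namespace of a single-conjunct summit repeats the summit name by design (D-0017)
set_option linter.dupNamespace false

noncomputable section

open scoped Classical
open Function WeierstrassCurve CongruenceSubgroup
  Literature.NumberTheory.EllipticCurves Literature.NumberTheory.EllipticCurves.ModularForms
  Summit.BirchSwinnertonDyer.BirchSwinnertonDyer.Theses.KimAtThreeKolyvagin
  Summit.BirchSwinnertonDyer.BirchSwinnertonDyer.Theorems.KimAtThreeKolyvaginIsogenyCruxes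
  Summit.BirchSwinnertonDyer.BirchSwinnertonDyer.Theorems.KimAtThreeKolyvaginMinimalCertificate

namespace Summit.BirchSwinnertonDyer.BirchSwinnertonDyer.Theorems.KimAtThreeKolyvaginIsogenyEndShape

/-- **Crux `DeepLowerAtThree` ⟸ the END-shape bound on every OPTIMAL parametrised tower row.** If for
every globally minimal `W₀` with the `3`-adic tower onto and `Ш` finite and every lattice-optimal,
degree-minimal datum `D₀` (any level) with `3`-integral plus symbols and `ord(δ̃) = 0` one has the unit
period transfer `Ω(W₀) = u·Ω⁺_{D₀.f}`, `‖u‖₃ = 1` (at an optimal datum: `3 ∤ c_{D₀}`) and, for some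
threshold `K`, the END-shape bound of n1011's (a′) road (every minimal certificate `δ̃_n ≢ 0 (mod 3^{j′})`
at a cyclic `n ∈ 𝒩_L(E,3)` with `K + j′ ≤ L + 1` gives `ord₃(L(E,1)/Ω(W₀)) ≤ ord₃ #Ш(3) + (j′ − 1)`), then
`DeepLowerAtThree` holds — for EVERY tower row and newform, by the isogeny transport.
[cite: Kim2025RefinedTNC, Thm 1.1] [cite: Kim2022StructureSelmer, Thm. 1.9 (6)] [cite: EdixhovenManin1991, Prop. 2] -/
theorem deepLowerAtThree_of_endShapeBound_optimal
    (h : ∀ (W₀ : WeierstrassCurve ℚ) [W₀.IsElliptic] [W₀.IsGloballyMinimal],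
      (∀ n : ℕ, W₀.HasSurjectiveModNGaloisRep (3 ^ n : ℕ)) → Finite W₀.sha →
      ∀ {N : ℕ} [NeZero N] (D₀ : ModularParametrizationData W₀ N),
        (∀ z ∈ D₀.L.lattice, ∃ w ∈ periodLattice D₀.f, z = D₀.c * w) →
        (∀ (W₂ : WeierstrassCurve ℚ) [W₂.IsElliptic] (D₂ : ModularParametrizationData W₂ N),
          D₂.f = D₀.f → D₀.modularDegree ≤ D₂.modularDegree) →
        (∀ r : ℚ, ratPlusSymbol D₀.f r ≠ 0 → 0 ≤ padicValRat 3 (ratPlusSymbol D₀.f r)) →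
        kuriharaVanishingOrder W₀ 3 D₀.f = 0 →
        (∃ u : ℚ, ‖(u : ℚ_[3])‖ = 1 ∧ W₀.realPeriodRat = u * plusPeriod D₀.f) ∧
        ∃ K : ℕ, ∀ (j' L n : ℕ), 1 ≤ j' → K + j' ≤ L + 1 → IsCyclicKolyvaginLevel W₀ 3 n →
          ∀ hL : Kato.IsKolyvaginProduct W₀ 3 L n,
          ∀ ψ : (ℓ : ℕ) → (ZMod ℓ)ˣ →* Multiplicative (ZMod (3 ^ j')),
            (∀ ℓ ∈ n.primeFactors, Function.Surjective (ψ ℓ)) →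
            (haveI : NeZero n := ⟨hL.ne_zero⟩; kuriharaNumber D₀.f (3 ^ j') n ψ ≠ 0) →
            (∀ d : ℕ, d ∣ n → 1 < d → d < n → ∀ [NeZero d], kuriharaNumber D₀.f (3 ^ j') d ψ = 0) →
            ∃ q : ℚ, W₀.entireLFunction 1 / (W₀.realPeriodRat : ℂ) = (q : ℂ) ∧
              padicValRat 3 q ≤
                (padicValNat 3 (Nat.card (AddCommGroup.primaryComponent W₀.sha 3)) : ℤ) +
                  ((j' - 1 : ℕ) : ℤ)) :
    DeepLowerAtThree := by
  refine deepLowerAtThree_of_forall_optimalDatum fun W₀ _ _ htow hfin N _ D₀ hopt hdeg hint hord => ?_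
  obtain ⟨hper, K, hEnd⟩ := h W₀ htow hfin D₀ hopt hdeg hint hord
  exact deepLower_datum_of_endShapeBound W₀ htow D₀ hper hord K hEnd

end Summit.BirchSwinnertonDyer.BirchSwinnertonDyer.Theorems.KimAtThreeKolyvaginIsogenyEndShape

end
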